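import Summits.ValiantsHypothesis.ValiantsHypothesis.Theorems.LacunarySymmetroidMatrixDescartesDoorA26ClosureChamberBridge

/-!
# `DoorA26` — the census → closure bridge on a face with DOMINATED TIES: one chamber row suffices

HONEST FRAMING.  Object-search cell `pub-symmetroid`, door-A target `DoorA26 := PosRootLawAt 2 6 19`
(stmt-ValiantsHypothesis-19979; OPEN, typed, never asserted).  Seat val-sym-door-p2 g16 (#3).  A corollary of the census → closure
bridge `not_mem_closure_twentyLocus_of_sortedRows` (`…DoorA26ClosureChamberBridge`, #1), deciding nothing about the door.

SETTING.  `δ₀ ∈ ℝ⁶` monotone (a point of the sorted simplex, possibly on Weyl faces `δ₀ᵢ = δ₀ᵢ₊₁` and on walls) and an order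
`σ : Fin 21 → Fin 6 × Fin 6` of canonical index pairs along which the pair sums of `δ₀` are WEAKLY increasing.  Call a tie
`δ₀(σ t) = δ₀(σ (t+1))` between consecutive entries DOMINATED if `σ t ≤ σ (t+1)` coordinatewise and `σ t ≠ σ (t+1)`: then EVERY strictly
increasing integer support `d` has `d(σ t) < d(σ (t+1))` automatically.  If all ties of `δ₀` along `σ` are dominated, every sorted
integer support inheriting the strict pair-sum inequalities of `δ₀` lies in the chamber of `σ`, so THE ONE ROW of `σ`
(`∀ d, StrictMono (pairSum d ∘ σ) → PosRootLawOn 2 6 19 d`, the shape of the census theorems `doorA26_on_chamber<n>`) gives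
`δ₀ ∉ closure TwentyLocus` (`not_mem_closure_twentyLocus_of_dominatedTies`, by-id form `…_of_chamber_dominatedTies`, and the
`Bubbling.TwentyLocus` twins for the W-line).

WHERE IT APPLIES (located census of this seat, `HOME/val-sym-door-p2/g16/exp/closure_census.py`, theory g6's table of the 2 608
chambers vs the 1 363 kernel rows of 2026-08-29): a value-generic point of a GENERIC WEYL FACE (exactly one coincidence
`δ₀ᵢ = δ₀ᵢ₊₁`; the W-line's `(W_gen)`, reduced there to the OPEN analytic doors `ConfluentDoor26 ∧ NoTightChain26NC`) has ALL its ties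
dominated (`(i,i) < (i,i+1) < (i+1,i+1)` and `(i,x) < (i+1,x)`), hence exactly ONE refining chamber: 570 components (5 faces × 114
orders), of which 136 have their chamber certified today ⇒ `(W_gen)` holds on those 136 components by this file + the row, with no
analysis.  Ties that are NOT dominated (`(i+1,i+1)` vs `(i,i+2)` at a triple, `(0,3)` vs `(1,2)` at two pairs, any mixed/disjoint wall)
need one row per refining chamber (`…DoorA26TripleStratumCertifiedComponents`, #2, does the six fully certified triple components).

Nothing here is a row or a certificate; `DoorA26`, (W), (M), (R), `ConfluentDoor26`, `TripleStratum26`, `MatrixDescartes`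
(stmt-ValiantsHypothesis-18050) OPEN; registers unchanged; nothing on `VP ≠ VNP`.  `--supports stmt-ValiantsHypothesis-19979 --as helper`.

[folklore] Elementary order bookkeeping; no citation exists or is needed.
-/

-- `Summit.ValiantsHypothesis.ValiantsHypothesis.…` repeats a component by the D-0017 layout
-- (single-conjunct summit), which the `dupNamespace` linter flags; the name is mandated.
set_option linter.dupNamespace false

namespace Summit.ValiantsHypothesis.ValiantsHypothesis.Theorems.LacunarySymmetroidMatrixDescartes.Census.RealExp

open Summit.ValiantsHypothesis.ValiantsHypothesis.Theorems.LacunarySymmetroidMatrixDescartes.WallBubbling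

/-- **Dominated ties are automatic for sorted supports.**  If `σ` lists canonical pairs, the pair sums of a monotone `δ₀` increase
weakly along `σ` with every tie dominated, and a strictly increasing integer support `d` inherits the strict canonical pair-sum
inequalities of `δ₀`, then the pair sums of `d` increase STRICTLY along `σ`. [this work] -/
theorem strictMono_pairSum_of_dominatedTies (δ₀ : Fin 6 → ℝ) (σ : Fin 21 → Fin 6 × Fin 6)
    (hcanon : ∀ t, (σ t).1 ≤ (σ t).2)
    (hmono : Monotone ((fun p : Fin 6 × Fin 6 => δ₀ p.1 + δ₀ p.2) ∘ σ))
    (hties : ∀ t : Fin 20, δ₀ (σ t.castSucc).1 + δ₀ (σ t.castSucc).2 = δ₀ (σ t.succ).1 + δ₀ (σ t.succ).2 →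
      (σ t.castSucc).1 ≤ (σ t.succ).1 ∧ (σ t.castSucc).2 ≤ (σ t.succ).2 ∧ σ t.castSucc ≠ σ t.succ)
    (d : Fin 6 → ℕ) (hd : StrictMono d)
    (hinh : ∀ p q : Fin 6 × Fin 6, p.1 ≤ p.2 → q.1 ≤ q.2 → δ₀ p.1 + δ₀ p.2 < δ₀ q.1 + δ₀ q.2 →
      d p.1 + d p.2 < d q.1 + d q.2) :
    StrictMono ((fun p : Fin 6 × Fin 6 => d p.1 + d p.2) ∘ σ) := by
  refine Fin.strictMono_iff_lt_succ.mpr fun t => ?_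
  show d (σ t.castSucc).1 + d (σ t.castSucc).2 < d (σ t.succ).1 + d (σ t.succ).2
  have hle : δ₀ (σ t.castSucc).1 + δ₀ (σ t.castSucc).2 ≤ δ₀ (σ t.succ).1 + δ₀ (σ t.succ).2 :=
    hmono t.castSucc_lt_succ.le
  rcases hle.eq_or_lt with heq | hlt
  · obtain ⟨h1, h2, hne⟩ := hties t heq
    have m1 : d (σ t.castSucc).1 ≤ d (σ t.succ).1 := hd.monotone h1
    have m2 : d (σ t.castSucc).2 ≤ d (σ t.succ).2 := hd.monotone h2
    rcases h1.eq_or_lt with e1 | l1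
    · have l2 : (σ t.castSucc).2 < (σ t.succ).2 := lt_of_le_of_ne h2 fun e2 => hne (Prod.ext e1 e2)
      have s2 : d (σ t.castSucc).2 < d (σ t.succ).2 := hd l2
      omega
    · have s1 : d (σ t.castSucc).1 < d (σ t.succ).1 := hd l1
      omega
  · exact hinh _ _ (hcanon _) (hcanon _) hlt

/-- **ONE ROW SUFFICES WHEN ALL TIES ARE DOMINATED.**  For a monotone `δ₀ ∈ ℝ⁶` whose pair sums increase weakly along an order `σ` of
canonical pairs with every tie dominated, the chamber row of `σ` alone puts `δ₀` outside `closure TwentyLocus`. [this work] -/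
theorem not_mem_closure_twentyLocus_of_dominatedTies (δ₀ : Fin 6 → ℝ) (hδ₀ : Monotone δ₀) (σ : Fin 21 → Fin 6 × Fin 6)
    (hcanon : ∀ t, (σ t).1 ≤ (σ t).2)
    (hmono : Monotone ((fun p : Fin 6 × Fin 6 => δ₀ p.1 + δ₀ p.2) ∘ σ))
    (hties : ∀ t : Fin 20, δ₀ (σ t.castSucc).1 + δ₀ (σ t.castSucc).2 = δ₀ (σ t.succ).1 + δ₀ (σ t.succ).2 →
      (σ t.castSucc).1 ≤ (σ t.succ).1 ∧ (σ t.castSucc).2 ≤ (σ t.succ).2 ∧ σ t.castSucc ≠ σ t.succ)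
    (hrow : ∀ d : Fin 6 → ℕ, StrictMono ((fun p : Fin 6 × Fin 6 => d p.1 + d p.2) ∘ σ) → PosRootLawOn 2 6 19 d) :
    δ₀ ∉ closure {δ : Fin 6 → ℝ | ∃ S : Fin 6 → Matrix (Fin 2) (Fin 2) ℝ, (∀ l, (S l).IsSymm) ∧
      20 ≤ {x : ℝ | 0 < x ∧ (∑ l, (x ^ (δ l)) • S l).det = 0}.ncard} :=
  not_mem_closure_twentyLocus_of_sortedRows δ₀ hδ₀ fun d hd hinh =>
    hrow d (strictMono_pairSum_of_dominatedTies δ₀ σ hcanon hmono hties d hd hinh)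

/-- **By chamber id** (`σ := Census.chamber n`; `hrow` := a landed `doorA26_on_chamber<n>` verbatim): a monotone `δ₀` whose pair sums
increase weakly along chamber `n` with dominated ties — e.g. a value-generic point of a generic Weyl face, whose refining chamber is
unique — is outside `closure TwentyLocus` as soon as chamber `n` is certified. [this work] -/
theorem not_mem_closure_twentyLocus_of_chamber_dominatedTies (δ₀ : Fin 6 → ℝ) (hδ₀ : Monotone δ₀) (n : ℕ)
    (hcanon : ∀ t, (chamber n t).1 ≤ (chamber n t).2)
    (hmono : Monotone ((fun p : Fin 6 × Fin 6 => δ₀ p.1 + δ₀ p.2) ∘ chamber n))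
    (hties : ∀ t : Fin 20, δ₀ (chamber n t.castSucc).1 + δ₀ (chamber n t.castSucc).2
        = δ₀ (chamber n t.succ).1 + δ₀ (chamber n t.succ).2 →
      (chamber n t.castSucc).1 ≤ (chamber n t.succ).1 ∧ (chamber n t.castSucc).2 ≤ (chamber n t.succ).2 ∧
        chamber n t.castSucc ≠ chamber n t.succ)
    (hrow : ∀ d : Fin 6 → ℕ, StrictMono ((fun p : Fin 6 × Fin 6 => d p.1 + d p.2) ∘ chamber n) →
      PosRootLawOn 2 6 19 d) :
    δ₀ ∉ closure {δ : Fin 6 → ℝ | ∃ S : Fin 6 → Matrix (Fin 2) (Fin 2) ℝ, (∀ l, (S l).IsSymm) ∧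
      20 ≤ {x : ℝ | 0 < x ∧ (∑ l, (x ^ (δ l)) • S l).det = 0}.ncard} :=
  not_mem_closure_twentyLocus_of_dominatedTies δ₀ hδ₀ (chamber n) hcanon hmono hties hrow

/-- **W-line currency.**  Same conclusion for `Bubbling.TwentyLocus` (the set of `tripleStratum26_of_chains`, `weylFaces_generic`, …).
[this work] -/
theorem not_mem_closure_bubblingTwentyLocus_of_dominatedTies (δ₀ : Fin 6 → ℝ) (hδ₀ : Monotone δ₀)
    (σ : Fin 21 → Fin 6 × Fin 6) (hcanon : ∀ t, (σ t).1 ≤ (σ t).2)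
    (hmono : Monotone ((fun p : Fin 6 × Fin 6 => δ₀ p.1 + δ₀ p.2) ∘ σ))
    (hties : ∀ t : Fin 20, δ₀ (σ t.castSucc).1 + δ₀ (σ t.castSucc).2 = δ₀ (σ t.succ).1 + δ₀ (σ t.succ).2 →
      (σ t.castSucc).1 ≤ (σ t.succ).1 ∧ (σ t.castSucc).2 ≤ (σ t.succ).2 ∧ σ t.castSucc ≠ σ t.succ)
    (hrow : ∀ d : Fin 6 → ℕ, StrictMono ((fun p : Fin 6 × Fin 6 => d p.1 + d p.2) ∘ σ) → PosRootLawOn 2 6 19 d) :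
    δ₀ ∉ closure Bubbling.TwentyLocus :=
  not_mem_closure_twentyLocus_of_dominatedTies δ₀ hδ₀ σ hcanon hmono hties hrow

/-- **W-line currency, by chamber id.** [this work] -/
theorem not_mem_closure_bubblingTwentyLocus_of_chamber_dominatedTies (δ₀ : Fin 6 → ℝ) (hδ₀ : Monotone δ₀) (n : ℕ)
    (hcanon : ∀ t, (chamber n t).1 ≤ (chamber n t).2)
    (hmono : Monotone ((fun p : Fin 6 × Fin 6 => δ₀ p.1 + δ₀ p.2) ∘ chamber n))
    (hties : ∀ t : Fin 20, δ₀ (chamber n t.castSucc).1 + δ₀ (chamber n t.castSucc).2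
        = δ₀ (chamber n t.succ).1 + δ₀ (chamber n t.succ).2 →
      (chamber n t.castSucc).1 ≤ (chamber n t.succ).1 ∧ (chamber n t.castSucc).2 ≤ (chamber n t.succ).2 ∧
        chamber n t.castSucc ≠ chamber n t.succ)
    (hrow : ∀ d : Fin 6 → ℕ, StrictMono ((fun p : Fin 6 × Fin 6 => d p.1 + d p.2) ∘ chamber n) →
      PosRootLawOn 2 6 19 d) :
    δ₀ ∉ closure Bubbling.TwentyLocus :=
  not_mem_closure_twentyLocus_of_dominatedTies δ₀ hδ₀ (chamber n) hcanon hmono hties hrow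

end Summit.ValiantsHypothesis.ValiantsHypothesis.Theorems.LacunarySymmetroidMatrixDescartes.Census.RealExp
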